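/-
# [B4] THEOREM (1.10), DERIVATIVE MEMBER, ON A BOX `Ω` — the walk route for the probe `D^η_{A,μ}` (R9 bridge, file 7)

statement-level skeleton of published theorems with citation tags; proofs where landed; nothing here is a claim about
the Yang–Mills mass gap

[B4] = Balaban, *Regularity and decay of lattice Green's functions*, Commun. Math. Phys. 89 (1983) 571–597.

THEOREM p.573, (1.10) second member: «|(D^η_{A,μ}G_k(Ω,A)f)(x)| ≤ c₀e^{−δ₀dist(x, supp f)}‖f‖_∞»,
`(D^η_{A,μ}φ)(x) = η^{-1}(U(A_{⟨x,x+ηe_μ⟩})φ(x+ηe_μ) − φ(x))` ((1.3) p.572).  r01 proved the §2 walk route for an ARBITRARY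
local probe (`B4Ineq19WalkRoute.probe_bound`: `‖P·G·1_F‖ ≤ 2m₀α_P e^{ρ+13/8}e^{−D/M}` from `α_P ≥ ‖P·h_jG_jh_j‖`).  THIS
FILE takes `P = η^{-1}(E_{xy}[U(A_{xy})] − E_{xx}[1])`, `y = x + e_μ`, on the box carriers of `B4Thm110BoxWalk` and derives
`α_P` from the lineage's `supN` inputs by the Leibniz rule (2.3) `P·h_j = h_j(x)P + η^{-1}(h_j(y) − h_j(x))E_{xy}[U]` with
`η^{-1}|h_j(y) − h_j(x)| ≤ s/K` (`B4Eq220PartitionSizes.hsize_hBox`; p.577 «|∂^ηh_j| ≤ O(M^{-1})»):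
`α_P = √N c_D + (s/K)·N√N c_G` with `c_D` the DERIVATIVE sup bound of Lemma 2.2 (2.17) for the cube propagators — the
constant is UNIFORM IN `η`, as printed.  `thm110_deriv_box`: arbitrary `A`, cube configurations agreeing with `A` on the
plateaus, inputs `c_G, c_D, c_K` as hypotheses ⇒ `|(D^η_{A,μ}G_k(Ω,A)f)(x)| ≤ 2^{d+3}e^{19/8}α_P e^{−D/K}‖f‖_∞` for
`x, x+e_μ ∈ Ω`, `f` supported at unit-lattice sup-distance `≥ D` from `x`; `thm110_deriv_box_cubeField`: `A = compField Ac`,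
`Ã_j = B4CubeFields22.cubeField`, inputs in the output form of `B4Eq220CubeField`.

HONEST SCOPE.  Boxes; forward bond inside `Ω`; `ℓ^∞` over sites and colours (hence `√N`, `N`); per-cube inputs are
hypotheses here (discharged for a regular field constant near `∂Ω` in `B4Thm110BoxDerivRegular`).  No `def`, no `Prop`
fact, no `sorry`; axioms standard.
-/
import Literature.MathematicalPhysics.QuantumFieldTheory.Balaban1983to89.B4Thm110BoxWalk
import Literature.MathematicalPhysics.QuantumFieldTheory.Balaban1983to89.B4Ineq19WalkRoute

namespace Literature.MathematicalPhysics.QuantumFieldTheory.Balaban1983to89.B4Thm110BoxDerivWalk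

open Literature.MathematicalPhysics.QuantumFieldTheory.Balaban1983to89.B4Reflection242 (boxDom mem_boxDom nbrs mem_nbrs
  blk)
open Literature.MathematicalPhysics.QuantumFieldTheory.Balaban1983to89.B4GaugeCovariance
open Literature.MathematicalPhysics.QuantumFieldTheory.Balaban1983to89.B4Commutators25to211 (mulH opK)
open Literature.MathematicalPhysics.QuantumFieldTheory.Balaban1983to89.B4Lower18Regular (e1 baseEmb stairContour)
open Literature.MathematicalPhysics.QuantumFieldTheory.Balaban1983to89.B4Lower18RegularRegion (compField)
open Literature.MathematicalPhysics.QuantumFieldTheory.Balaban1983to89.B4Lemma21Region (siteNorm covDeriv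
  fld_covDeriv_mulVec_of_mem)
open Literature.MathematicalPhysics.QuantumFieldTheory.Balaban1983to89.B4Lemma22ReduceZero (Box opA greenA derivA)
open Literature.MathematicalPhysics.QuantumFieldTheory.Balaban1983to89.B4Lemma22Reduce231 (supN supN_nonneg le_supN
  supN_le siteNorm_nonneg siteNorm_zero fld_zero)
open Literature.MathematicalPhysics.QuantumFieldTheory.Balaban1983to89.B4Lemma22Invertible (opA_stair_isUnit_det)
open Literature.MathematicalPhysics.QuantumFieldTheory.Balaban1983to89.B4PartitionUnity22 (hCube hCube_nonneg hCube_le_one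
  hCube_ne_zero_imp mem_box_of_hCube_ne_zero hprof D1 D2 D1_nonneg D2_nonneg contDiff_hprof hasCompactSupport_hprof)
open Literature.MathematicalPhysics.QuantumFieldTheory.Balaban1983to89.B4Green242Bridge (boxNbrs)
open Literature.MathematicalPhysics.QuantumFieldTheory.Balaban1983to89.B4Eq220CommutatorZeroBox (HSize mem_boxNbrs_iff)
open Literature.MathematicalPhysics.QuantumFieldTheory.Balaban1983to89.B4Eq220PartitionSizes (hBox hsize_hBox)
open Literature.MathematicalPhysics.QuantumFieldTheory.Balaban1983to89.B4Eq220CommutatorField (kOp)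
open Literature.MathematicalPhysics.QuantumFieldTheory.Balaban1983to89.B4Ineq110WalkRoute (norm_mulH_le)
open Literature.MathematicalPhysics.QuantumFieldTheory.Balaban1983to89.B4Ineq110WalkRouteDeriv (unitOp_apply
  unitOp_mul_mulH norm_unitOp_le fld_bondOp_mulVec)
open Literature.MathematicalPhysics.QuantumFieldTheory.Balaban1983to89.B4Ineq19WalkRoute (probe_bound)
open Literature.MathematicalPhysics.QuantumFieldTheory.Balaban1983to89.B4CubeOpReindex (linfty_opNorm_le_of_supN)
open Literature.MathematicalPhysics.QuantumFieldTheory.Balaban1983to89.B4CubeFields22 (cubeField cubeField_eq_compField)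
open Literature.MathematicalPhysics.QuantumFieldTheory.Balaban1983to89.B4BoxCubeGeometry
open Literature.MathematicalPhysics.QuantumFieldTheory.Balaban1983to89.B4Thm110BoxWalk (plateau_fine)
open scoped Matrix
open scoped Matrix.Norms.Operator

noncomputable section

variable {d : ℕ}
variable {ι : Type} [Fintype ι] [DecidableEq ι]

/-! ## 1. The derivative probe `P = η^{-1}(E_{xy}[U] − E_{xx}[1])`: algebra -/

section Probe

variable {X : Type} [Fintype X] [DecidableEq X]

omit [Fintype ι] [DecidableEq ι] [Fintype X] [DecidableEq X] in
/-- a row sum is at most the `ℓ^∞`-operator norm. [folklore] -/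
private theorem row_sum_le_norm {m n : Type} [Fintype m] [Fintype n] (A : Matrix m n ℝ) (i : m) :
    ∑ j, |A i j| ≤ ‖A‖ := by
  rw [Matrix.linfty_opNorm_def]
  have h : (∑ j, ‖A i j‖₊ : NNReal) ≤ Finset.univ.sup fun i => ∑ j, ‖A i j‖₊ :=
    Finset.le_sup (f := fun i => ∑ j, ‖A i j‖₊) (Finset.mem_univ i)
  have h' := NNReal.coe_le_coe.mpr h
  simp only [NNReal.coe_sum, coe_nnnorm, Real.norm_eq_abs] at h'
  exact h'

omit [Fintype ι] [DecidableEq ι] [Fintype X] [DecidableEq X] in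
/-- `|(Af)_i| ≤ ‖A‖·sup|f|`. [folklore] -/
private theorem abs_mulVec_le {m n : Type} [Fintype m] [Fintype n] (A : Matrix m n ℝ) (f : n → ℝ) {φ : ℝ}
    (hφ : 0 ≤ φ) (hf : ∀ j, |f j| ≤ φ) (i : m) : |(A *ᵥ f) i| ≤ ‖A‖ * φ := by
  rw [Matrix.mulVec, dotProduct]
  calc |∑ j, A i j * f j| ≤ ∑ j, |A i j * f j| := Finset.abs_sum_le_sum_abs _ _
    _ ≤ ∑ j, |A i j| * φ := Finset.sum_le_sum fun j _ => by
        rw [abs_mul]; exact mul_le_mul_of_nonneg_left (hf j) (abs_nonneg _)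
    _ = (∑ j, |A i j|) * φ := by rw [Finset.sum_mul]
    _ ≤ ‖A‖ * φ := mul_le_mul_of_nonneg_right (row_sum_le_norm A i) hφ

/-- **THE LEIBNIZ RULE (2.3) FOR THE DERIVATIVE PROBE**: `P·h = h(x)·P + η^{-1}(h(y) − h(x))·E_{xy}[U]`.
[cite: Balaban1983RegularityDecay, (2.3) p.575] -/
theorem probe_mul_mulH (x y : X) (B : Matrix ι ι ℝ) (r : ℝ) (h : X → ℝ) :
    (r • (unitOp x y B - unitOp x x (1 : Matrix ι ι ℝ))) * mulH (ι := ι) h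
      = h x • (r • (unitOp x y B - unitOp x x (1 : Matrix ι ι ℝ))) + (r * (h y - h x)) • unitOp x y B := by
  rw [Matrix.smul_mul, Matrix.sub_mul, unitOp_mul_mulH, unitOp_mul_mulH]
  ext p p'
  simp only [Matrix.smul_apply, Matrix.sub_apply, Matrix.add_apply, smul_eq_mul]
  ring

/-- the probe acts at the site `x` by `r·(Bφ(y) − φ(x))`. [cite: Balaban1983RegularityDecay, (1.3) p.572] -/
theorem fld_probe_mulVec_self (x y : X) (B : Matrix ι ι ℝ) (r : ℝ) (Ψ : X × ι → ℝ) :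
    fld ((r • (unitOp x y B - unitOp x x (1 : Matrix ι ι ℝ))) *ᵥ Ψ) x = r • (B *ᵥ fld Ψ y - fld Ψ x) := by
  rw [Matrix.smul_mulVec]
  have h := fld_bondOp_mulVec x y (fun _ _ => B) Ψ
  rw [← h]
  rfl

omit [Fintype ι] in
/-- the probe vanishes at every other site. [cite: Balaban1983RegularityDecay, (1.3) p.572] -/
theorem fld_probe_mulVec_ne [Fintype ι] (x y : X) (B : Matrix ι ι ℝ) (r : ℝ) (Ψ : X × ι → ℝ) {z : X} (hz : z ≠ x) :
    fld ((r • (unitOp x y B - unitOp x x (1 : Matrix ι ι ℝ))) *ᵥ Ψ) z = 0 := by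
  funext k
  simp only [fld_apply, Matrix.mulVec, dotProduct, Matrix.smul_apply, Matrix.sub_apply, unitOp_apply, hz,
    false_and, if_false, sub_zero, smul_zero, zero_mul, Finset.sum_const_zero, Pi.zero_apply]

/-- the rows of an orthogonal link variable `U(t)` have `ℓ¹`-norm `≤ N`. [cite: Balaban1983RegularityDecay, (1.2) p.572
«U(A) ∈ O(N)»] -/
theorem row_abs_sum_U_le (F : OrthFlow ι) (t : ℝ) (k : ι) : ∑ k', |F.U t k k'| ≤ (Fintype.card ι : ℝ) := by
  have hUU : F.U t * (F.U t)ᵀ = 1 := mul_eq_one_comm.mp (F.orth t)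
  have hdiag : ∑ k', F.U t k k' * F.U t k k' = 1 := by
    have := congrFun (congrFun hUU k) k
    rw [Matrix.mul_apply, Matrix.one_apply_eq] at this
    simpa only [Matrix.transpose_apply] using this
  have hle : ∀ k', |F.U t k k'| ≤ 1 := fun k' => by
    have h1 : F.U t k k' * F.U t k k' ≤ 1 := by
      rw [← hdiag]
      exact Finset.single_le_sum (f := fun j => F.U t k j * F.U t k j) (fun j _ => mul_self_nonneg _)
        (Finset.mem_univ k')
    exact abs_le_one_iff_mul_self_le_one.mpr h1
  calc ∑ k', |F.U t k k'| ≤ ∑ _k' : ι, (1 : ℝ) := Finset.sum_le_sum fun k' _ => hle k'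
    _ = Fintype.card ι := by simp

/-- the labels whose `h_j` can see a point number at most `2^{d+1}` (two integers per coordinate).
[cite: Balaban1983RegularityDecay, §2 p.575] -/
private theorem card_labelBox_le (M : ℝ) (p : Fin (d + 1) → ℝ) :
    (Fintype.piFinset fun μ => ({⌊p μ / M⌋, ⌊p μ / M⌋ + 1} : Finset ℤ)).card ≤ 2 ^ (d + 1) := by
  rw [Fintype.card_piFinset]
  calc ∏ μ, ({⌊p μ / M⌋, ⌊p μ / M⌋ + 1} : Finset ℤ).card ≤ 2 ^ (Finset.univ : Finset (Fin (d + 1))).card :=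
        Finset.prod_le_pow_card _ _ 2 fun μ _ => Finset.card_le_two
    _ = 2 ^ (d + 1) := by rw [Finset.card_univ, Fintype.card_fin]

end Probe

/-! ## 2. THEOREM (1.10), derivative member, on a box -/

/-- **THEOREM (1.10) ON A BOX `Ω`, DERIVATIVE MEMBER — THE WALK ROUTE FOR THE PROBE `D^η_{A,μ}` ASSEMBLED.**  Data as in
`B4Thm110BoxWalk.thm110_value_box` (box `Ω = Box d ℓ k Mb`, `K` the large-cube size with `8 ≤ K`, `4 ∣ K`, `K ∣ Mb_μ`;
an arbitrary `A`; cube configurations `Ã_j` agreeing with `A` on the plateaus), and for every label `j`: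
`‖G_k(Ω,Ã_j)Φ‖_∞ ≤ c_G‖Φ‖_∞`, `‖D^η_{Ã_j,μ}G_k(Ω,Ã_j)Φ‖_∞ ≤ c_D‖Φ‖_∞` (Lemma 2.2 (2.17), `n = 0, 1`),
`‖K_{h_j}G_k(Ω,Ã_j)h_jΦ‖_∞ ≤ c_K‖Φ‖_∞` ((2.20)), `3^{d+1}√N c_K ≤ e^{−1}` ((2.21)).  Then for `x, x + e_μ ∈ Ω` and `f`
supported in a set `P` at unit-lattice sup-distance `≥ D` from `x`, `|f| ≤ φ`:
`|(D^η_{A,μ}G_k(Ω,A)f)(x)| ≤ 2^{d+3}e^{19/8}·(√N c_D + (s/K)·N√N c_G)·e^{−D/K}·φ`, `s = (d+1)(sup|h′| + sup|h″|)`.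
[cite: Balaban1983RegularityDecay, Theorem (1.10) p.573; (2.3) p.575, (2.13) p.577, (2.18)–(2.22) pp.578–579] -/
theorem thm110_deriv_box (F : OrthFlow ι) (κ : ℝ) {ℓ k : ℕ} (hℓ : 1 ≤ ℓ) (hk : 1 ≤ k) (hn : 1 ≤ (ℓ + 1) ^ k)
    (Mb : Fin (d + 1) → ℕ) {K : ℕ} (hK8 : 8 ≤ K) (h4 : 4 ∣ K) (hKM : ∀ μ, K ∣ Mb μ) {a m2 : ℝ} (ha : 0 < a)
    (hm : 0 ≤ m2) (A : ↥(Box d ℓ k Mb) → ↥(Box d ℓ k Mb) → ℝ)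
    (Ac : (Fin (d + 1) → ℤ) → ↥(Box d ℓ k Mb) → ↥(Box d ℓ k Mb) → ℝ)
    (hplat : ∀ j (u v : ↥(Box d ℓ k Mb)), (∀ ν, |posR ℓ k Mb u ν - (K : ℝ) * j ν| ≤ 3 / 4 * (K : ℝ)) →
      (∀ ν, |posR ℓ k Mb v ν - (K : ℝ) * j ν| ≤ 3 / 4 * (K : ℝ)) → Ac j u v = A u v)
    {cG cD cK : ℝ} (hcG : 0 ≤ cG) (hcD : 0 ≤ cD) (hcK : 0 ≤ cK)
    (hG : ∀ j ∈ labels Mb, ∀ Φ : ↥(Box d ℓ k Mb) × ι → ℝ,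
      supN (greenA d F κ ℓ k a m2 Mb (baseEmb hn Mb) (stairContour hn Mb) (Ac j) *ᵥ Φ) ≤ cG * supN Φ)
    (μ : Fin (d + 1))
    (hDG : ∀ j ∈ labels Mb, ∀ Φ : ↥(Box d ℓ k Mb) × ι → ℝ,
      supN (derivA d F κ ℓ k Mb (Ac j) μ
        *ᵥ (greenA d F κ ℓ k a m2 Mb (baseEmb hn Mb) (stairContour hn Mb) (Ac j) *ᵥ Φ)) ≤ cD * supN Φ)
    (hKG : ∀ j ∈ labels Mb, ∀ Φ : ↥(Box d ℓ k Mb) × ι → ℝ,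
      supN (kOp F κ ((ℓ + 1) ^ k) (B1.aSeq a ((ℓ : ℝ) + 1) k) m2 Mb (baseEmb hn Mb) (stairContour hn Mb) (Ac j)
            (hBox ((ℓ + 1) ^ k) K Mb j)
          *ᵥ (greenA d F κ ℓ k a m2 Mb (baseEmb hn Mb) (stairContour hn Mb) (Ac j)
            *ᵥ (mulH (ι := ι) (hBox ((ℓ + 1) ^ k) K Mb j) *ᵥ Φ))) ≤ cK * supN Φ)
    (h3 : (3 : ℝ) ^ (d + 1) * (Real.sqrt (Fintype.card ι) * cK) ≤ Real.exp (-1))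
    (x : ↥(Box d ℓ k Mb)) (hxμ : x.1 + e1 μ ∈ Box d ℓ k Mb) (P : ↥(Box d ℓ k Mb) → Prop) [DecidablePred P]
    {D : ℝ} (hD : ∀ x', P x' → ∃ ν, D ≤ |posR ℓ k Mb x ν - posR ℓ k Mb x' ν|)
    (f : ↥(Box d ℓ k Mb) × ι → ℝ) (hfP : ∀ p, ¬ P p.1 → f p = 0) {φ : ℝ} (hφ : 0 ≤ φ) (hf : ∀ p, |f p| ≤ φ)
    (i : ι) :
    |(derivA d F κ ℓ k Mb A μ
        *ᵥ (greenA d F κ ℓ k a m2 Mb (baseEmb hn Mb) (stairContour hn Mb) A *ᵥ f)) (x, i)|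
      ≤ 2 ^ (d + 3) * Real.exp (19 / 8)
          * (Real.sqrt (Fintype.card ι) * cD
              + ((d : ℝ) + 1) * (D1 hprof + D2 hprof) / K
                  * ((Fintype.card ι : ℝ) * (Real.sqrt (Fintype.card ι) * cG)))
          * Real.exp (-(D / K)) * φ := by
  classical
  have hK1 : 1 ≤ K := le_trans (by norm_num) hK8
  have hKr : (0 : ℝ) < K := by exact_mod_cast hK1
  have hK8r : (8 : ℝ) ≤ K := by exact_mod_cast hK8
  have hnr : (0 : ℝ) < (((ℓ + 1) ^ k : ℕ) : ℝ) := by exact_mod_cast hn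
  have hnK : 3 ≤ (ℓ + 1) ^ k * K := by nlinarith
  have hs0 : 0 ≤ ((d : ℝ) + 1) * (D1 hprof + D2 hprof) := by
    have := D1_nonneg contDiff_hprof hasCompactSupport_hprof
    have := D2_nonneg contDiff_hprof hasCompactSupport_hprof
    positivity
  -- the bond `⟨x, y⟩`
  set y : ↥(Box d ℓ k Mb) := ⟨x.1 + e1 μ, hxμ⟩ with hy
  have hyn : y.1 ∈ nbrs x.1 := mem_nbrs.2 ⟨μ, Or.inl rfl⟩
  have hxy : ∀ ν, |posR ℓ k Mb x ν - posR ℓ k Mb y ν| ≤ 1 / 8 * (K : ℝ) := by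
    refine boxWt_local hK8 ?_
    unfold boxWt
    rw [if_pos hyn, mul_one]
    positivity
  -- abbreviations for the walk route's data
  set Gr : (Fin (d + 1) → ℤ) → Matrix (↥(Box d ℓ k Mb) × ι) (↥(Box d ℓ k Mb) × ι) ℝ :=
    fun j => greenA d F κ ℓ k a m2 Mb (baseEmb hn Mb) (stairContour hn Mb) (Ac j) with hGr
  set hh : (Fin (d + 1) → ℤ) → ↥(Box d ℓ k Mb) → ℝ := fun j z => hCube (K : ℝ) j (posR ℓ k Mb z) with hhh
  have hh_abs : ∀ j z, |hh j z| ≤ 1 := fun j z => by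
    rw [hhh, abs_of_nonneg (hCube_nonneg _ _ _)]; exact hCube_le_one _ _ _
  -- the probe
  set Wxy : Matrix ι ι ℝ := fieldLink F κ A x y with hWxy
  set Pr : Matrix (↥(Box d ℓ k Mb) × ι) (↥(Box d ℓ k Mb) × ι) ℝ :=
    ((((ℓ + 1) ^ k : ℕ)) : ℝ) • (unitOp x y Wxy - unitOp x x (1 : Matrix ι ι ℝ)) with hPr
  have hw : ∀ k', ∑ k'', |Wxy k' k''| ≤ (Fintype.card ι : ℝ) := fun k' => row_abs_sum_U_le F _ k'
  -- the starting cubes `S₀` (those seeing `x` or `y`), at most `2^{d+2}`, within `¾K` of `x`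
  set S₀ : Finset ↥(labels Mb) := Finset.univ.filter fun j => hh j.1 x ≠ 0 ∨ hh j.1 y ≠ 0 with hS₀
  have hcard : S₀.card ≤ 2 ^ (d + 2) := by
    have hsub : S₀.map (Function.Embedding.subtype (· ∈ labels Mb))
        ⊆ (Fintype.piFinset fun ν => ({⌊posR ℓ k Mb x ν / K⌋, ⌊posR ℓ k Mb x ν / K⌋ + 1} : Finset ℤ))
          ∪ (Fintype.piFinset fun ν => ({⌊posR ℓ k Mb y ν / K⌋, ⌊posR ℓ k Mb y ν / K⌋ + 1} : Finset ℤ)) := by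
      intro j hj
      obtain ⟨i', hi', rfl⟩ := Finset.mem_map.mp hj
      obtain ⟨-, hixy⟩ := Finset.mem_filter.mp hi'
      rcases hixy with hix | hiy
      · exact Finset.mem_union_left _ (mem_box_of_hCube_ne_zero hix)
      · exact Finset.mem_union_right _ (mem_box_of_hCube_ne_zero hiy)
    calc S₀.card = (S₀.map (Function.Embedding.subtype (· ∈ labels Mb))).card := (Finset.card_map _).symm
      _ ≤ _ := Finset.card_le_card hsub
      _ ≤ _ := Finset.card_union_le _ _
      _ ≤ 2 ^ (d + 1) + 2 ^ (d + 1) :=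
          add_le_add (card_labelBox_le (K : ℝ) (posR ℓ k Mb x)) (card_labelBox_le (K : ℝ) (posR ℓ k Mb y))
      _ = 2 ^ (d + 2) := by ring
  have hP0 : ∀ j : ↥(labels Mb), j ∉ S₀ → Pr * mulH (ι := ι) (hh j.1) = 0 := by
    intro j hj
    have hjx : hh j.1 x = 0 := by
      by_contra h0; exact hj (Finset.mem_filter.mpr ⟨Finset.mem_univ _, Or.inl h0⟩)
    have hjy : hh j.1 y = 0 := by
      by_contra h0; exact hj (Finset.mem_filter.mpr ⟨Finset.mem_univ _, Or.inr h0⟩)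
    rw [hPr, probe_mul_mulH, hjx, hjy, sub_zero, mul_zero, zero_smul, zero_smul, add_zero]
  have hnear : ∀ j : Fin (d + 1) → ℤ, (hh j x ≠ 0 ∨ hh j y ≠ 0) →
      ∀ ν, |posR ℓ k Mb x ν - (K : ℝ) * j ν| < 3 / 4 * (K : ℝ) := by
    intro j hj ν
    rcases hj with hjx | hjy
    · exact (hCube_ne_zero_imp hKr hjx ν).trans (by nlinarith)
    · have h1 := hCube_ne_zero_imp hKr hjy ν
      have h2 := hxy ν
      calc |posR ℓ k Mb x ν - (K : ℝ) * j ν|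
          ≤ |posR ℓ k Mb x ν - posR ℓ k Mb y ν| + |posR ℓ k Mb y ν - (K : ℝ) * j ν| := abs_sub_le _ _ _
        _ < 1 / 8 * (K : ℝ) + 5 / 8 * (K : ℝ) := add_lt_add_of_le_of_lt h2 h1
        _ = 3 / 4 * (K : ℝ) := by ring
  have hS₀ρ : ∀ j ∈ S₀, ∀ ν, |posR ℓ k Mb x ν - (K : ℝ) * j.1 ν| < 3 / 4 * (K : ℝ) := fun j hj =>
    hnear j.1 (Finset.mem_filter.mp hj).2
  -- plateau: if `h_j` sees `x` or `y`, both `x` and `y` are in the plateau of `□_j`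
  have hplx : ∀ j : Fin (d + 1) → ℤ, (hh j x ≠ 0 ∨ hh j y ≠ 0) →
      (∀ ν, |posR ℓ k Mb x ν - (K : ℝ) * j ν| ≤ 3 / 4 * (K : ℝ)) ∧
      (∀ ν, |posR ℓ k Mb y ν - (K : ℝ) * j ν| ≤ 3 / 4 * (K : ℝ)) := by
    intro j hj
    refine ⟨fun ν => (hnear j hj ν).le, fun ν => ?_⟩
    rcases hj with hjx | hjy
    · have h1 := hCube_ne_zero_imp hKr hjx ν
      have h2 := hxy ν
      rw [abs_sub_comm] at h2
      calc |posR ℓ k Mb y ν - (K : ℝ) * j ν|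
          ≤ |posR ℓ k Mb y ν - posR ℓ k Mb x ν| + |posR ℓ k Mb x ν - (K : ℝ) * j ν| := abs_sub_le _ _ _
        _ ≤ 1 / 8 * (K : ℝ) + 5 / 8 * (K : ℝ) := add_le_add h2 h1.le
        _ = 3 / 4 * (K : ℝ) := by ring
    · exact (hCube_ne_zero_imp hKr hjy ν).le.trans (by nlinarith)
  -- the per-cube input `α_P` by the Leibniz rule (2.3)
  set αP : ℝ := Real.sqrt (Fintype.card ι) * cD
    + ((d : ℝ) + 1) * (D1 hprof + D2 hprof) / K
        * ((Fintype.card ι : ℝ) * (Real.sqrt (Fintype.card ι) * cG)) with hαP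
  have hαP0 : 0 ≤ αP := by positivity
  have hαPj : ∀ j : ↥(labels Mb), ‖Pr * (mulH (ι := ι) (hh j.1) * Gr j.1 * mulH (ι := ι) (hh j.1))‖ ≤ αP := by
    intro j
    have hMh : ‖mulH (ι := ι) (hh j.1)‖ ≤ 1 := norm_mulH_le _ zero_le_one (hh_abs j.1)
    have hGn : ‖Gr j.1‖ ≤ Real.sqrt (Fintype.card ι) * cG := linfty_opNorm_le_of_supN _ hcG (hG j.1 j.2)
    have hE : ‖unitOp x y Wxy‖ ≤ (Fintype.card ι : ℝ) := norm_unitOp_le x y Wxy (Nat.cast_nonneg _) hw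
    -- `η^{-1}|h_j(y) − h_j(x)| ≤ s/K`
    have hgrad : |((((ℓ + 1) ^ k : ℕ)) : ℝ) * (hh j.1 y - hh j.1 x)|
        ≤ ((d : ℝ) + 1) * (D1 hprof + D2 hprof) / K := by
      rw [abs_mul, abs_of_pos hnr]
      exact (hsize_hBox hn hK1 hnK hKM j.1).grad_le x y (mem_boxNbrs_iff.2 hyn)
    -- the first Leibniz term: `‖P·G_j‖ ≤ √N c_D` when `h_j(x) ≠ 0`, and the term is absent when `h_j(x) = 0`
    have hfirst : |hh j.1 x| * ‖Pr * Gr j.1 * mulH (ι := ι) (hh j.1)‖ ≤ Real.sqrt (Fintype.card ι) * cD := by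
      by_cases hjx : hh j.1 x = 0
      · rw [hjx, abs_zero, zero_mul]; positivity
      · have hpl := hplx j.1 (Or.inl hjx)
        have hWA : Wxy = fieldLink F κ (Ac j.1) x y := by
          rw [hWxy]
          show F.U (κ * A x y) = F.U (κ * Ac j.1 x y)
          rw [hplat j.1 x y hpl.1 hpl.2]
        have hPG : ‖Pr * Gr j.1‖ ≤ Real.sqrt (Fintype.card ι) * cD := by
          refine linfty_opNorm_le_of_supN _ hcD fun Φ => ?_
          rw [← Matrix.mulVec_mulVec]
          refine supN_le (mul_nonneg hcD (supN_nonneg Φ)) fun z => ?_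
          by_cases hz : z = x
          · subst hz
            rw [hPr, fld_probe_mulVec_self, hWA, ← fld_covDeriv_mulVec_of_mem ((ℓ + 1) ^ k)
              (fieldLink F κ (Ac j.1)) (Gr j.1 *ᵥ Φ) hxμ]
            exact (le_supN _ _).trans (hDG j.1 j.2 Φ)
          · rw [hPr, fld_probe_mulVec_ne _ _ _ _ _ hz, siteNorm_zero]
            exact mul_nonneg hcD (supN_nonneg Φ)
        calc |hh j.1 x| * ‖Pr * Gr j.1 * mulH (ι := ι) (hh j.1)‖
            ≤ 1 * (‖Pr * Gr j.1‖ * ‖mulH (ι := ι) (hh j.1)‖) :=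
              mul_le_mul (hh_abs j.1 x) (norm_mul_le _ _) (norm_nonneg _) zero_le_one
          _ ≤ 1 * (Real.sqrt (Fintype.card ι) * cD * 1) := by
              refine mul_le_mul_of_nonneg_left (mul_le_mul hPG hMh (norm_nonneg _) (by positivity)) zero_le_one
          _ = Real.sqrt (Fintype.card ι) * cD := by ring
    have hsecond : |((((ℓ + 1) ^ k : ℕ)) : ℝ) * (hh j.1 y - hh j.1 x)|
        * ‖unitOp x y Wxy * Gr j.1 * mulH (ι := ι) (hh j.1)‖
        ≤ ((d : ℝ) + 1) * (D1 hprof + D2 hprof) / K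
            * ((Fintype.card ι : ℝ) * (Real.sqrt (Fintype.card ι) * cG)) := by
      refine mul_le_mul hgrad ?_ (norm_nonneg _) (by positivity)
      calc ‖unitOp x y Wxy * Gr j.1 * mulH (ι := ι) (hh j.1)‖
          ≤ ‖unitOp x y Wxy‖ * ‖Gr j.1‖ * ‖mulH (ι := ι) (hh j.1)‖ :=
            (norm_mul_le _ _).trans (mul_le_mul_of_nonneg_right (norm_mul_le _ _) (norm_nonneg _))
        _ ≤ (Fintype.card ι : ℝ) * (Real.sqrt (Fintype.card ι) * cG) * 1 :=
            mul_le_mul (mul_le_mul hE hGn (norm_nonneg _) (Nat.cast_nonneg _)) hMh (norm_nonneg _)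
              (by positivity)
        _ = (Fintype.card ι : ℝ) * (Real.sqrt (Fintype.card ι) * cG) := mul_one _
    have hsplit : Pr * (mulH (ι := ι) (hh j.1) * Gr j.1 * mulH (ι := ι) (hh j.1))
        = hh j.1 x • (Pr * Gr j.1 * mulH (ι := ι) (hh j.1))
          + (((((ℓ + 1) ^ k : ℕ)) : ℝ) * (hh j.1 y - hh j.1 x)) • (unitOp x y Wxy * Gr j.1 * mulH (ι := ι) (hh j.1)) := by
      rw [show Pr * (mulH (ι := ι) (hh j.1) * Gr j.1 * mulH (ι := ι) (hh j.1))
          = Pr * mulH (ι := ι) (hh j.1) * Gr j.1 * mulH (ι := ι) (hh j.1) by simp only [Matrix.mul_assoc],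
        hPr, probe_mul_mulH]
      simp only [Matrix.add_mul, Matrix.smul_mul]
    rw [hsplit]
    refine (norm_add_le _ _).trans ?_
    rw [norm_smul, norm_smul, Real.norm_eq_abs, Real.norm_eq_abs, hαP]
    exact add_le_add hfirst hsecond
  -- the walk route for the probe
  have main := probe_bound (X := ↥(Box d ℓ k Mb)) (Y := ↥(boxDom Mb)) (κ := ι) hKr (posR ℓ k Mb)
    (boxWt ((ℓ + 1) ^ k) (fun i => (ℓ + 1) ^ k * Mb i)) m2
    (B1.aSeq a ((ℓ : ℝ) + 1) k * (((((ℓ + 1) ^ k : ℕ)) : ℝ) ^ (d + 1))⁻¹)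
    (blkWt ((ℓ + 1) ^ k) Mb (fun i => (ℓ + 1) ^ k * Mb i)) (fieldLink F κ A)
    (contourTrans (fieldLink F κ A) (baseEmb hn Mb) (stairContour hn Mb))
    (fun _ _ h => boxWt_local hK8 h) (fun _ _ _ h h' => blkWt_local hK8 h h')
    (labels Mb) (fun j z h => mem_labels_of_hCube_ne_zero hK1 j z h)
    (fun _ _ => True) (fun _ _ _ => trivial)
    (fun j => fieldLink F κ (Ac j))
    (fun j => contourTrans (fieldLink F κ (Ac j)) (baseEmb hn Mb) (stairContour hn Mb))
    (fun j u v hu hv => by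
      show F.U (κ * Ac j u v) = F.U (κ * A u v)
      rw [hplat j u v hu hv])
    (fun j y' u hq hu => contourTrans_plateau F κ h4 hn (hplat j) hu hq)
    Gr
    (fun j _ => by
      simp only [iff_self, if_true]
      exact Matrix.mul_nonsing_inv _ (opA_stair_isUnit_det F κ hℓ hk hn ha hm Mb (Ac j)))
    (greenA d F κ ℓ k a m2 Mb (baseEmb hn Mb) (stairContour hn Mb) A)
    (Matrix.nonsing_inv_mul _ (opA_stair_isUnit_det F κ hℓ hk hn ha hm Mb A))
    Pr S₀ (m₀ := 2 ^ (d + 2)) hcard hP0 x (ρ := 3 / 4) hS₀ρ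
    (β := Real.sqrt (Fintype.card ι) * cK) hαP0 hαPj (by positivity)
    (fun j => by
      simp only [iff_self, if_true]
      refine linfty_opNorm_le_of_supN _ hcK fun Φ => ?_
      rw [← Matrix.mulVec_mulVec, ← Matrix.mulVec_mulVec]
      exact hKG j.1 j.2 Φ)
    h3 P hD
  -- the entry `(x, i)` of `P·G·1_P f = D^η_{A,μ}G f`
  have h1P : mulH (ι := ι) (fun z => if P z then (1 : ℝ) else 0) *ᵥ f = f := by
    ext p
    rw [B4Ineq110WalkRoute.mulH_mulVec_apply]
    by_cases hz : P p.1
    · rw [if_pos hz, one_mul]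
    · rw [if_neg hz, zero_mul, hfP p hz]
  have hentry : ((Pr * greenA d F κ ℓ k a m2 Mb (baseEmb hn Mb) (stairContour hn Mb) A
      * mulH (ι := ι) (fun z => if P z then (1 : ℝ) else 0)) *ᵥ f) (x, i)
      = (derivA d F κ ℓ k Mb A μ
          *ᵥ (greenA d F κ ℓ k a m2 Mb (baseEmb hn Mb) (stairContour hn Mb) A *ᵥ f)) (x, i) := by
    rw [← Matrix.mulVec_mulVec, ← Matrix.mulVec_mulVec, h1P]
    have h1 := fld_probe_mulVec_self x y Wxy ((((ℓ + 1) ^ k : ℕ)) : ℝ)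
      (greenA d F κ ℓ k a m2 Mb (baseEmb hn Mb) (stairContour hn Mb) A *ᵥ f)
    have h2 := fld_covDeriv_mulVec_of_mem ((ℓ + 1) ^ k) (fieldLink F κ A)
      (greenA d F κ ℓ k a m2 Mb (baseEmb hn Mb) (stairContour hn Mb) A *ᵥ f) (μ := μ) hxμ
    have h12 := h1.trans h2.symm
    exact congrFun h12 i
  rw [← hentry]
  refine (abs_mulVec_le _ f hφ hf (x, i)).trans ?_
  refine mul_le_mul_of_nonneg_right (main.trans (le_of_eq ?_)) hφ
  rw [show (3 : ℝ) / 4 + 13 / 8 = 19 / 8 by norm_num]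
  push_cast
  ring

/-! ## 3. The print's cube configurations `Ã_j` -/

/-- **THEOREM (1.10), DERIVATIVE MEMBER, ON A BOX FOR `A = compField Ac` AND THE PRINT'S `Ã_j = A₀ + θ_j(A − A₀)`**
(`B4CubeFields22.cubeField`): the plateau agreement is p35's `cubeField_eq_compField`; the remaining inputs are in the
exact output form of `B4Eq220CubeField.lemma22_sup_cubeField` (.1, .2) and `eq220_cubeField` at the interior cubes.
[cite: Balaban1983RegularityDecay, Theorem (1.10) p.573; §2 pp.575–579] -/
theorem thm110_deriv_box_cubeField (F : OrthFlow ι) {ℓ k : ℕ} (hℓ : 1 ≤ ℓ) (hk : 1 ≤ k) (hn : 1 ≤ (ℓ + 1) ^ k)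
    (Mb : Fin (d + 1) → ℕ) {K : ℕ} (hK8 : 8 ≤ K) (h4 : 4 ∣ K) (hKM : ∀ μ, K ∣ Mb μ) {a m2 : ℝ} (ha : 0 < a)
    (hm : 0 ≤ m2) (e : ℝ) (Ac : (Fin (d + 1) → ℤ) → Fin (d + 1) → ℝ) {cG cD cK : ℝ} (hcG : 0 ≤ cG)
    (hcD : 0 ≤ cD) (hcK : 0 ≤ cK)
    (hG : ∀ j ∈ labels Mb, ∀ Φ : ↥(Box d ℓ k Mb) × ι → ℝ,
      supN (greenA d F (e / ((ℓ + 1) ^ k : ℕ)) ℓ k a m2 Mb (baseEmb hn Mb) (stairContour hn Mb)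
          (cubeField (Box d ℓ k Mb) ((ℓ + 1) ^ k) K j (Ac 0) Ac) *ᵥ Φ) ≤ cG * supN Φ)
    (μ : Fin (d + 1))
    (hDG : ∀ j ∈ labels Mb, ∀ Φ : ↥(Box d ℓ k Mb) × ι → ℝ,
      supN (derivA d F (e / ((ℓ + 1) ^ k : ℕ)) ℓ k Mb (cubeField (Box d ℓ k Mb) ((ℓ + 1) ^ k) K j (Ac 0) Ac) μ
        *ᵥ (greenA d F (e / ((ℓ + 1) ^ k : ℕ)) ℓ k a m2 Mb (baseEmb hn Mb) (stairContour hn Mb)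
            (cubeField (Box d ℓ k Mb) ((ℓ + 1) ^ k) K j (Ac 0) Ac) *ᵥ Φ)) ≤ cD * supN Φ)
    (hKG : ∀ j ∈ labels Mb, ∀ Φ : ↥(Box d ℓ k Mb) × ι → ℝ,
      supN (kOp F (e / ((ℓ + 1) ^ k : ℕ)) ((ℓ + 1) ^ k) (B1.aSeq a ((ℓ : ℝ) + 1) k) m2 Mb (baseEmb hn Mb)
            (stairContour hn Mb) (cubeField (Box d ℓ k Mb) ((ℓ + 1) ^ k) K j (Ac 0) Ac) (hBox ((ℓ + 1) ^ k) K Mb j)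
          *ᵥ (greenA d F (e / ((ℓ + 1) ^ k : ℕ)) ℓ k a m2 Mb (baseEmb hn Mb) (stairContour hn Mb)
              (cubeField (Box d ℓ k Mb) ((ℓ + 1) ^ k) K j (Ac 0) Ac)
            *ᵥ (mulH (ι := ι) (hBox ((ℓ + 1) ^ k) K Mb j) *ᵥ Φ))) ≤ cK * supN Φ)
    (h3 : (3 : ℝ) ^ (d + 1) * (Real.sqrt (Fintype.card ι) * cK) ≤ Real.exp (-1))
    (x : ↥(Box d ℓ k Mb)) (hxμ : x.1 + e1 μ ∈ Box d ℓ k Mb) (P : ↥(Box d ℓ k Mb) → Prop) [DecidablePred P]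
    {D : ℝ} (hD : ∀ x', P x' → ∃ ν, D ≤ |posR ℓ k Mb x ν - posR ℓ k Mb x' ν|)
    (f : ↥(Box d ℓ k Mb) × ι → ℝ) (hfP : ∀ p, ¬ P p.1 → f p = 0) {φ : ℝ} (hφ : 0 ≤ φ) (hf : ∀ p, |f p| ≤ φ)
    (i : ι) :
    |(derivA d F (e / ((ℓ + 1) ^ k : ℕ)) ℓ k Mb (fun u v : ↥(Box d ℓ k Mb) => compField Ac u.1 v.1) μ
        *ᵥ (greenA d F (e / ((ℓ + 1) ^ k : ℕ)) ℓ k a m2 Mb (baseEmb hn Mb) (stairContour hn Mb)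
            (fun u v : ↥(Box d ℓ k Mb) => compField Ac u.1 v.1) *ᵥ f)) (x, i)|
      ≤ 2 ^ (d + 3) * Real.exp (19 / 8)
          * (Real.sqrt (Fintype.card ι) * cD
              + ((d : ℝ) + 1) * (D1 hprof + D2 hprof) / K
                  * ((Fintype.card ι : ℝ) * (Real.sqrt (Fintype.card ι) * cG)))
          * Real.exp (-(D / K)) * φ := by
  have hK1 : 1 ≤ K := le_trans (by norm_num) hK8
  exact thm110_deriv_box F (e / ((ℓ + 1) ^ k : ℕ)) hℓ hk hn Mb hK8 h4 hKM ha hm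
    (fun u v : ↥(Box d ℓ k Mb) => compField Ac u.1 v.1)
    (fun j => cubeField (Box d ℓ k Mb) ((ℓ + 1) ^ k) K j (Ac 0) Ac)
    (fun j u v hu hv => cubeField_eq_compField hn hK1 j (Ac 0) Ac (fun ν => plateau_fine hu ν)
      (fun ν => plateau_fine hv ν))
    hcG hcD hcK hG μ hDG hKG h3 x hxμ P hD f hfP hφ hf i

end

end Literature.MathematicalPhysics.QuantumFieldTheory.Balaban1983to89.B4Thm110BoxDerivWalk
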